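import Summits.Ventures.LatticeQCDFlow.Exactness.IMHAnyStartPathSplit
import HarnessLib

/-!
# Warm starts: a start carrying the fraction `m` of the target keeps it, a start with density `≤ M` stays below
# `(1 + (M − 1)rⁿ)·π` — two-sided MULTIPLICATIVE envelopes for flow-MCMC from warm starts, and the hot start is one
# update ahead of every start

HONEST FRAMING: exact (Metropolis-corrected) sampling algorithms for lattice gauge theory;
figures of merit are autocorrelation/cost numbers at stated couplings and volumes; no
continuum-physics claim.

Venture `LatticeQCDFlow` (cell pub-lqcd), topic `Exactness`; FANOUT row 30 (lean-1, GEN-34).  NEW WORK of the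
cell, general state space.  The exact split `μ₀Kⁿ = (1 − rⁿ)·π + rⁿ·μ₀Rⁿ` (`Exactness/IMHAnyStartSplit`, this
generation; `K = indepMH q w`, `x₀` a mode of the normalised weight, `A = 1/w(x₀)`, `r = 1 − A`, `R` the residual
kernel, `πR = π`) is MONOTONE AND LINEAR in the start.  Hence order information on the start propagates exactly:

* §1 `bind_mono_measure` ∕ `iterate_bind_mono_measure` — `μ ≤ ν ⇒ μRⁿ ≤ νRⁿ` (every kernel); with `πRⁿ = π`
  (**`iterate_bind_residual_target`**):
  **`iterate_bind_indepMH_ge_of_ge`** — A START CARRYING THE FRACTION `m` OF THE TARGET (`m·π ≤ μ₀`, e.g. a previous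
  run's output law, or the hot start below) satisfies `μ₀Kⁿ ≥ (1 − (1 − m)rⁿ)·π` — the lower envelope `1 − rⁿ` of an
  arbitrary start improved to `1 − (1 − m)rⁿ`; **`iterate_bind_indepMH_le_of_le`** — A START WITH DENSITY AT MOST `M`
  (`μ₀ ≤ M·π`, e.g. reweighting from a nearby coupling) satisfies `μ₀Kⁿ ≤ (1 + (M − 1)rⁿ)·π`: the time-`n` law has
  density in `[1 − (1 − m)rⁿ, 1 + (M − 1)rⁿ]` against the target — RELATIVE accuracy, for rare events too.
* §2 **`hotStart_ge_target`** — THE HOT START (`μ₀ = q = (1/w)·π`) carries the fraction `A = 1/w(x₀)` of the target,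
  `q ≥ A·π` — what ONE update gives from anywhere; so (**`iterate_bind_indepMH_hotStart_ge`**) `qKⁿ ≥ (1 − rⁿ⁺¹)·π`:
  THE HOT START IS ONE UPDATE AHEAD OF EVERY START; `w ≥ w_min > 0 ⇒ qKⁿ ≤ (1 + (1/w_min − 1)rⁿ)·π` (`…_hotStart_le`).
* §3 on path space: **`imh_chain_shift_real_ge_of_ge`** — `m·π ≤ μ₀ ⇒ P_{μ₀}(X_{b+·} ∈ E) ≥ (1 − (1 − m)r^b)·P_π(E)`;
  **`imh_chain_shift_real_le_of_le`** — `μ₀ ≤ M·π ⇒ P_{μ₀}(X_{b+·} ∈ E) ≤ (1 + (M − 1)r^b)·P_π(E)`: after `b` discarded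
  updates EVERY STATISTIC OF A WARM-STARTED RUN IS WITHIN THE FACTORS `[1 − (1 − m)r^b, 1 + (M − 1)r^b]` OF ITS EQUILIBRIUM
  VALUE — relative, not absolute, error (nonnegative statistics: **`imh_chain_shift_integral_ge_of_ge`** ∕ **`…_le_of_le`**);
  **`imh_chain_shift_real_hotStart_ge`** — from the hot start `P_q(X_{b+·} ∈ E) ≥ (1 − r^{b+1})·P_π(E)`.

Reading (gauge files): a run started from a proposal draw is never behind a run started anywhere else and discarded once
more; a start with density `≤ M` against the target reports every statistic within relative error `(M − 1)(1 − A)^b`.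
NOT CLAIMED: `m`, `M` for a concrete start; the total-variation contraction `‖μ₀Kⁿ − π‖ ≤ rⁿ‖μ₀ − π‖` (not typed).
No `sorry`, no new definitions, nothing cited as a fact; general measurable space.
-/

noncomputable section

namespace Summit.Ventures.LatticeQCDFlow.Exactness

open MeasureTheory ProbabilityTheory Function
open scoped ENNReal
open Summit.Ventures.LatticeQCDFlow.Scoring Literature.Probability.MarkovChains

variable {Ω : Type*} [MeasurableSpace Ω] {q : Measure Ω} [IsProbabilityMeasure q] {w : Ω → ℝ}

/-! ## §1 Order in the start propagates: the multiplicative envelopes -/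

/-- `bind` is monotone in the measure (every kernel). [ours, bookkeeping] -/
theorem bind_mono_measure (κ : Kernel Ω Ω) {μ ν : Measure Ω} (h : μ ≤ ν) : μ.bind κ ≤ ν.bind κ :=
  Measure.le_iff.2 fun B hB => by
    rw [Measure.bind_apply hB (Kernel.aemeasurable _), Measure.bind_apply hB (Kernel.aemeasurable _)]
    exact lintegral_mono' h le_rfl

/-- Scalar multiples are monotone in the measure. [ours, bookkeeping] -/
theorem smul_measure_mono (c : ℝ≥0∞) {μ ν : Measure Ω} (h : μ ≤ ν) : c • μ ≤ c • ν :=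
  Measure.le_iff'.2 fun B => by simpa only [Measure.smul_apply, smul_eq_mul] using mul_le_mul_right (Measure.le_iff'.1 h B) c
/-- Iterated `bind` is monotone in the initial measure. [ours, bookkeeping] -/
theorem iterate_bind_mono_measure (κ : Kernel Ω Ω) {μ ν : Measure Ω} (h : μ ≤ ν) (n : ℕ) :
    (fun m : Measure Ω => m.bind κ)^[n] μ ≤ (fun m : Measure Ω => m.bind κ)^[n] ν := by
  induction n with
  | zero => simpa
  | succ n ih =>
    rw [Function.iterate_succ_apply', Function.iterate_succ_apply']
    exact bind_mono_measure κ ih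

/-- Iterated `bind` commutes with scalars. [ours, bookkeeping] -/
theorem iterate_bind_smul_measure (κ : Kernel Ω Ω) (c : ℝ≥0∞) (μ : Measure Ω) (n : ℕ) :
    (fun m : Measure Ω => m.bind κ)^[n] (c • μ) = c • (fun m : Measure Ω => m.bind κ)^[n] μ := by
  induction n with
  | zero => simp
  | succ n ih => rw [Function.iterate_succ_apply', Function.iterate_succ_apply', ih, Measure.bind_smul]

/-- **The target is invariant for the iterated residual chain**: `πRⁿ = π`. [ours] -/
theorem iterate_bind_residual_target [Fact (Measurable w)] (hw0 : ∀ y, 0 < w y) {x₀ : Ω}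
    (hmax : ∀ y, w y ≤ w x₀) (hlt : 1 < w x₀)
    [IsProbabilityMeasure (q.withDensity fun y => ENNReal.ofReal (w y))] (n : ℕ) :
    (fun m : Measure Ω => m.bind
        (Doeblin.residualKernel (indepMH q w) (q.withDensity fun y => ENNReal.ofReal (w y))
          (ENNReal.ofReal (w x₀)⁻¹) (indepMH_minorised_mode Fact.out hw0 hmax)))^[n]
        (q.withDensity fun y => ENNReal.ofReal (w y)) =
      q.withDensity fun y => ENNReal.ofReal (w y) := by
  induction n with
  | zero => rfl
  | succ n ih => rw [Function.iterate_succ_apply', ih, bind_residual_indepMH_target hw0 hmax hlt]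

/-- **A START CARRYING THE FRACTION `m` OF THE TARGET KEEPS IT, AND THE REST EQUILIBRATES AT RATE `r`**:
`m·π ≤ μ₀ ⇒ (1 − (1 − m)rⁿ)·π ≤ μ₀Kⁿ` (as measures). [ours] -/
theorem iterate_bind_indepMH_ge_of_ge [Fact (Measurable w)] (hw0 : ∀ y, 0 < w y) {x₀ : Ω}
    (hmax : ∀ y, w y ≤ w x₀) [IsProbabilityMeasure (q.withDensity fun y => ENNReal.ofReal (w y))]
    (μ₀ : Measure Ω) [IsProbabilityMeasure μ₀] {m : ℝ} (hm0 : 0 ≤ m)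
    (hlow : ENNReal.ofReal m • (q.withDensity fun y => ENNReal.ofReal (w y)) ≤ μ₀) (n : ℕ) :
    ENNReal.ofReal (1 - (1 - m) * (1 - (w x₀)⁻¹) ^ n) • (q.withDensity fun y => ENNReal.ofReal (w y)) ≤
      (fun m : Measure Ω => m.bind (indepMH q w))^[n] μ₀ := by
  set π : Measure Ω := q.withDensity fun y => ENNReal.ofReal (w y) with hπ
  have hW : 1 ≤ w x₀ := one_le_of_mode (q := q) hmax
  have hr0 : 0 ≤ 1 - (w x₀)⁻¹ := sub_nonneg.2 (inv_le_one_of_one_le₀ hW)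
  have hr1 : 1 - (w x₀)⁻¹ ≤ 1 := sub_le_self _ (inv_nonneg.mpr (hw0 x₀).le)
  rcases hW.lt_or_eq with hlt | h1
  · set ε : ℝ≥0∞ := ENNReal.ofReal (w x₀)⁻¹ with hε
    haveI := Doeblin.isMarkovKernel_residualKernel (κ := indepMH q w) (ν := π) (ε := ε)
      (hmin := indepMH_minorised_mode Fact.out hw0 hmax) (ofReal_inv_lt_one_of_one_lt hlt)
    set R := Doeblin.residualKernel (indepMH q w) π ε (indepMH_minorised_mode Fact.out hw0 hmax) with hR
    rw [iterate_bind_indepMH_eq_residual_mixture hw0 hmax hlt n μ₀]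
    -- `μ₀Rⁿ ≥ m·πRⁿ = m·π`
    have hres : ENNReal.ofReal m • π ≤ (fun m : Measure Ω => m.bind R)^[n] μ₀ := by
      have h := iterate_bind_mono_measure R hlow n
      rwa [iterate_bind_smul_measure, iterate_bind_residual_target hw0 hmax hlt n] at h
    calc ENNReal.ofReal (1 - (1 - m) * (1 - (w x₀)⁻¹) ^ n) • π
        = ENNReal.ofReal (1 - (1 - (w x₀)⁻¹) ^ n) • π +
            ENNReal.ofReal ((1 - (w x₀)⁻¹) ^ n) • (ENNReal.ofReal m • π) := by
          rw [smul_smul, ← ENNReal.ofReal_mul (pow_nonneg hr0 n), ← add_smul,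
            ← ENNReal.ofReal_add (sub_nonneg.2 (pow_le_one₀ hr0 hr1)) (mul_nonneg (pow_nonneg hr0 n) hm0)]
          congr 2; ring
      _ ≤ ENNReal.ofReal (1 - (1 - (w x₀)⁻¹) ^ n) • π +
            ENNReal.ofReal ((1 - (w x₀)⁻¹) ^ n) • (fun m : Measure Ω => m.bind R)^[n] μ₀ :=
          add_le_add le_rfl (smul_measure_mono _ hres)
  · -- `w(x₀) = 1`: `r = 0`, and for `n ≥ 1` the law is `π` itself
    rcases n with _ | n
    · simpa using hlow
    · have hstep : ∀ (m : Measure Ω) [IsProbabilityMeasure m], m.bind (indepMH q w) = π := by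
        intro m _
        ext B hB
        rw [Measure.bind_apply hB (Kernel.aemeasurable _)]
        simp_rw [indepMH_apply_eq_target_of_mode_eq_one Fact.out hw0 hmax h1.symm]
        rw [lintegral_const, measure_univ, mul_one]
      haveI := isProbabilityMeasure_iterate_bind (κ := indepMH q w) μ₀ n
      rw [Function.iterate_succ_apply', hstep, ← h1]
      have : ENNReal.ofReal (1 - (1 - m) * (1 - (1 : ℝ)⁻¹) ^ (n + 1)) = 1 := by simp
      rw [this, one_smul]

/-- **A START WITH DENSITY AT MOST `M` AGAINST THE TARGET STAYS BELOW `(1 + (M − 1)rⁿ)·π`**: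
`μ₀ ≤ M·π ⇒ μ₀Kⁿ ≤ (1 + (M − 1)rⁿ)·π` (`M ≥ 1`). [ours] -/
theorem iterate_bind_indepMH_le_of_le [Fact (Measurable w)] (hw0 : ∀ y, 0 < w y) {x₀ : Ω}
    (hmax : ∀ y, w y ≤ w x₀) [IsProbabilityMeasure (q.withDensity fun y => ENNReal.ofReal (w y))]
    (μ₀ : Measure Ω) [IsProbabilityMeasure μ₀] {M : ℝ} (hM1 : 1 ≤ M)
    (hup : μ₀ ≤ ENNReal.ofReal M • (q.withDensity fun y => ENNReal.ofReal (w y))) (n : ℕ) :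
    (fun m : Measure Ω => m.bind (indepMH q w))^[n] μ₀ ≤
      ENNReal.ofReal (1 + (M - 1) * (1 - (w x₀)⁻¹) ^ n) • (q.withDensity fun y => ENNReal.ofReal (w y)) := by
  set π : Measure Ω := q.withDensity fun y => ENNReal.ofReal (w y) with hπ
  have hW : 1 ≤ w x₀ := one_le_of_mode (q := q) hmax
  have hr0 : 0 ≤ 1 - (w x₀)⁻¹ := sub_nonneg.2 (inv_le_one_of_one_le₀ hW)
  have hr1 : 1 - (w x₀)⁻¹ ≤ 1 := sub_le_self _ (inv_nonneg.mpr (hw0 x₀).le)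
  have hM0 : 0 ≤ M := zero_le_one.trans hM1
  rcases hW.lt_or_eq with hlt | h1
  · set ε : ℝ≥0∞ := ENNReal.ofReal (w x₀)⁻¹ with hε
    haveI := Doeblin.isMarkovKernel_residualKernel (κ := indepMH q w) (ν := π) (ε := ε)
      (hmin := indepMH_minorised_mode Fact.out hw0 hmax) (ofReal_inv_lt_one_of_one_lt hlt)
    set R := Doeblin.residualKernel (indepMH q w) π ε (indepMH_minorised_mode Fact.out hw0 hmax) with hR
    rw [iterate_bind_indepMH_eq_residual_mixture hw0 hmax hlt n μ₀]
    have hres : (fun m : Measure Ω => m.bind R)^[n] μ₀ ≤ ENNReal.ofReal M • π := by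
      have h := iterate_bind_mono_measure R hup n
      rwa [iterate_bind_smul_measure, iterate_bind_residual_target hw0 hmax hlt n] at h
    calc ENNReal.ofReal (1 - (1 - (w x₀)⁻¹) ^ n) • π +
          ENNReal.ofReal ((1 - (w x₀)⁻¹) ^ n) • (fun m : Measure Ω => m.bind R)^[n] μ₀
        ≤ ENNReal.ofReal (1 - (1 - (w x₀)⁻¹) ^ n) • π +
            ENNReal.ofReal ((1 - (w x₀)⁻¹) ^ n) • (ENNReal.ofReal M • π) :=
          add_le_add le_rfl (smul_measure_mono _ hres)
      _ = ENNReal.ofReal (1 + (M - 1) * (1 - (w x₀)⁻¹) ^ n) • π := by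
          rw [smul_smul, ← ENNReal.ofReal_mul (pow_nonneg hr0 n), ← add_smul,
            ← ENNReal.ofReal_add (sub_nonneg.2 (pow_le_one₀ hr0 hr1)) (mul_nonneg (pow_nonneg hr0 n) hM0)]
          congr 2; ring
  · rcases n with _ | n
    · simpa using hup
    · have hstep : ∀ (m : Measure Ω) [IsProbabilityMeasure m], m.bind (indepMH q w) = π := by
        intro m _
        ext B hB
        rw [Measure.bind_apply hB (Kernel.aemeasurable _)]
        simp_rw [indepMH_apply_eq_target_of_mode_eq_one Fact.out hw0 hmax h1.symm]
        rw [lintegral_const, measure_univ, mul_one]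
      haveI := isProbabilityMeasure_iterate_bind (κ := indepMH q w) μ₀ n
      rw [Function.iterate_succ_apply', hstep, ← h1]
      have : ENNReal.ofReal (1 + (M - 1) * (1 - (1 : ℝ)⁻¹) ^ (n + 1)) = 1 := by simp
      rw [this, one_smul]

/-! ## §2 The hot start carries the fraction `A` of the target: one update ahead of every start -/

omit [IsProbabilityMeasure q] in
/-- **THE HOT START DOMINATES `A·π`**: the flow's own output law `q = (1/w)·π` satisfies `q ≥ (1/w(x₀))·π`. [ours] -/
theorem hotStart_ge_target (hw : Measurable w) (hw0 : ∀ y, 0 < w y) {x₀ : Ω} (hmax : ∀ y, w y ≤ w x₀) :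
    ENNReal.ofReal (w x₀)⁻¹ • (q.withDensity fun y => ENNReal.ofReal (w y)) ≤ q := by
  refine Measure.le_iff.2 fun B hB => ?_
  rw [Measure.smul_apply, smul_eq_mul, withDensity_apply _ hB, ← lintegral_const_mul _ hw.ennreal_ofReal]
  calc ∫⁻ y in B, ENNReal.ofReal (w x₀)⁻¹ * ENNReal.ofReal (w y) ∂q ≤ ∫⁻ _ in B, 1 ∂q := by
        refine lintegral_mono fun y => ?_
        rw [← ENNReal.ofReal_mul (inv_nonneg.mpr (hw0 x₀).le), ← ENNReal.ofReal_one]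
        exact ENNReal.ofReal_le_ofReal (by rw [inv_mul_le_iff₀ (hw0 x₀), mul_one]; exact hmax y)
    _ = q B := by rw [setLIntegral_const, one_mul]

omit [IsProbabilityMeasure q] in
/-- **THE HOT START IS BOUNDED BY `(1/w_min)·π`** when the weight is bounded below: `w ≥ w_min > 0 ⇒ q ≤ (1/w_min)·π`.
[ours] -/
theorem hotStart_le_target (hw : Measurable w) {wmin : ℝ} (hwmin : 0 < wmin) (hge : ∀ y, wmin ≤ w y) :
    q ≤ ENNReal.ofReal wmin⁻¹ • (q.withDensity fun y => ENNReal.ofReal (w y)) := by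
  refine Measure.le_iff.2 fun B hB => ?_
  rw [Measure.smul_apply, smul_eq_mul, withDensity_apply _ hB, ← lintegral_const_mul _ hw.ennreal_ofReal]
  calc q B = ∫⁻ _ in B, 1 ∂q := by rw [setLIntegral_const, one_mul]
    _ ≤ ∫⁻ y in B, ENNReal.ofReal wmin⁻¹ * ENNReal.ofReal (w y) ∂q := by
        refine lintegral_mono fun y => ?_
        rw [← ENNReal.ofReal_mul (inv_nonneg.mpr hwmin.le), ← ENNReal.ofReal_one]
        exact ENNReal.ofReal_le_ofReal (by rw [le_inv_mul_iff₀ hwmin, mul_one]; exact hge y)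

/-- **THE HOT START IS ONE UPDATE AHEAD**: `qKⁿ ≥ (1 − rⁿ⁺¹)·π` — the lower envelope an arbitrary start reaches after
`n + 1` updates. [ours] -/
theorem iterate_bind_indepMH_hotStart_ge [Fact (Measurable w)] (hw0 : ∀ y, 0 < w y) {x₀ : Ω}
    (hmax : ∀ y, w y ≤ w x₀) [IsProbabilityMeasure (q.withDensity fun y => ENNReal.ofReal (w y))] (n : ℕ) :
    ENNReal.ofReal (1 - (1 - (w x₀)⁻¹) ^ (n + 1)) • (q.withDensity fun y => ENNReal.ofReal (w y)) ≤
      (fun m : Measure Ω => m.bind (indepMH q w))^[n] q := by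
  have hW : 1 ≤ w x₀ := one_le_of_mode (q := q) hmax
  have h := iterate_bind_indepMH_ge_of_ge (q := q) hw0 hmax q (inv_nonneg.mpr (hw0 x₀).le)
    (hotStart_ge_target Fact.out hw0 hmax) n
  rwa [pow_succ']

/-- **… and stays below `(1 + (1/w_min − 1)rⁿ)·π`** when `w ≥ w_min > 0`. [ours] -/
theorem iterate_bind_indepMH_hotStart_le [Fact (Measurable w)] (hw0 : ∀ y, 0 < w y) {x₀ : Ω}
    (hmax : ∀ y, w y ≤ w x₀) [IsProbabilityMeasure (q.withDensity fun y => ENNReal.ofReal (w y))]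
    {wmin : ℝ} (hwmin : 0 < wmin) (hwmin1 : wmin ≤ 1) (hge : ∀ y, wmin ≤ w y) (n : ℕ) :
    (fun m : Measure Ω => m.bind (indepMH q w))^[n] q ≤
      ENNReal.ofReal (1 + (wmin⁻¹ - 1) * (1 - (w x₀)⁻¹) ^ n) • (q.withDensity fun y => ENNReal.ofReal (w y)) :=
  iterate_bind_indepMH_le_of_le (q := q) hw0 hmax q (one_le_inv_iff₀.2 ⟨hwmin, hwmin1⟩)
    (hotStart_le_target Fact.out hwmin hge) n

/-! ## §3 On path space: multiplicative envelopes for every statistic of a warm-started run -/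

/-- The chain law is monotone in the initial measure. [ours, bookkeeping] -/
theorem chain_mono_measure (κ : Kernel Ω Ω) [IsMarkovKernel κ] {μ ν : Measure Ω} (h : μ ≤ ν) :
    Kernel.trajMeasure (X := fun _ : ℕ => Ω) μ
        (fun n : ℕ => κ.comap (fun h : (i : ↥(Finset.Iic n)) → Ω => h ⟨n, Finset.mem_Iic.2 le_rfl⟩)
          (measurable_pi_apply _)) ≤
      Kernel.trajMeasure (X := fun _ : ℕ => Ω) ν
        (fun n : ℕ => κ.comap (fun h : (i : ↥(Finset.Iic n)) → Ω => h ⟨n, Finset.mem_Iic.2 le_rfl⟩)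
          (measurable_pi_apply _)) := by
  unfold Kernel.trajMeasure
  refine Measure.le_iff.2 fun S hS => ?_
  rw [Measure.bind_apply hS (Kernel.aemeasurable _), Measure.bind_apply hS (Kernel.aemeasurable _)]
  exact lintegral_mono' (Measure.map_mono h (MeasurableEquiv.measurable _)) le_rfl

/-- **WARM START, LOWER MULTIPLICATIVE ENVELOPE ON PATH SPACE**: `m·π ≤ μ₀` (`0 ≤ m ≤ 1`) ⇒ for every measurable set of
runs `E` and every `b`: `(1 − (1 − m)r^b)·P_π(E) ≤ P_{μ₀}(X_{b+·} ∈ E)`. [ours] -/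
theorem imh_chain_shift_real_ge_of_ge [Fact (Measurable w)] (hw0 : ∀ y, 0 < w y) {x₀ : Ω}
    (hmax : ∀ y, w y ≤ w x₀) [IsProbabilityMeasure (q.withDensity fun y => ENNReal.ofReal (w y))]
    (μ₀ : Measure Ω) [IsProbabilityMeasure μ₀] {m : ℝ} (hm0 : 0 ≤ m)
    (hlow : ENNReal.ofReal m • (q.withDensity fun y => ENNReal.ofReal (w y)) ≤ μ₀)
    {E : Set (ℕ → Ω)} (hE : MeasurableSet E) (b : ℕ) :
    (1 - (1 - m) * (1 - (w x₀)⁻¹) ^ b) *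
        (Kernel.trajMeasure (X := fun _ : ℕ => Ω) (q.withDensity fun y => ENNReal.ofReal (w y))
          (fun n : ℕ => (indepMH q w).comap (fun h : (i : ↥(Finset.Iic n)) → Ω => h ⟨n, Finset.mem_Iic.2 le_rfl⟩)
            (measurable_pi_apply _))).real E ≤
      (Kernel.trajMeasure (X := fun _ : ℕ => Ω) μ₀
        (fun n : ℕ => (indepMH q w).comap (fun h : (i : ↥(Finset.Iic n)) → Ω => h ⟨n, Finset.mem_Iic.2 le_rfl⟩)
          (measurable_pi_apply _))).real ((fun (x : ℕ → Ω) (n : ℕ) => x (b + n)) ⁻¹' E) := by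
  have hW : 1 ≤ w x₀ := one_le_of_mode (q := q) hmax
  have hr0 : 0 ≤ 1 - (w x₀)⁻¹ := sub_nonneg.2 (inv_le_one_of_one_le₀ hW)
  have hr1 : 1 - (w x₀)⁻¹ ≤ 1 := sub_le_self _ (inv_nonneg.mpr (hw0 x₀).le)
  have hc0 : 0 ≤ 1 - (1 - m) * (1 - (w x₀)⁻¹) ^ b := by
    have : (1 - m) * (1 - (w x₀)⁻¹) ^ b ≤ 1 * 1 :=
      mul_le_mul (sub_le_self _ hm0) (pow_le_one₀ hr0 hr1) (pow_nonneg hr0 b) zero_le_one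
    linarith
  have hΘ : Measurable (fun (x : ℕ → Ω) (n : ℕ) => x (b + n)) :=
    measurable_pi_lambda _ fun n => measurable_pi_apply _
  haveI := isProbabilityMeasure_iterate_bind (κ := indepMH q w) μ₀ b
  -- the shifted law is the chain from `μ₀K^b ≥ (1 − (1 − m)r^b)·π`
  have hmono := chain_mono_measure (indepMH q w) (iterate_bind_indepMH_ge_of_ge (q := q) hw0 hmax μ₀ hm0 hlow b)
  rw [← chain_map_shift_eq (indepMH q w) μ₀ b] at hmono
  have h := hmono E
  rw [Measure.map_apply hΘ hE] at h
  have hsmul := chain_add_smul (indepMH q w) (q.withDensity fun y => ENNReal.ofReal (w y)) 0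
    (ENNReal.ofReal (1 - (1 - m) * (1 - (w x₀)⁻¹) ^ b)) 0
  simp only [smul_zero, add_zero, zero_smul] at hsmul
  rw [hsmul, Measure.smul_apply, smul_eq_mul] at h
  rw [measureReal_def, measureReal_def, ← ENNReal.toReal_ofReal hc0, ← ENNReal.toReal_mul]
  exact ENNReal.toReal_mono (measure_ne_top _ _) h

/-- **WARM START, UPPER MULTIPLICATIVE ENVELOPE ON PATH SPACE**: `μ₀ ≤ M·π` (`M ≥ 1`) ⇒
`P_{μ₀}(X_{b+·} ∈ E) ≤ (1 + (M − 1)r^b)·P_π(E)` — relative accuracy for every statistic, rare events included. [ours] -/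
theorem imh_chain_shift_real_le_of_le [Fact (Measurable w)] (hw0 : ∀ y, 0 < w y) {x₀ : Ω}
    (hmax : ∀ y, w y ≤ w x₀) [IsProbabilityMeasure (q.withDensity fun y => ENNReal.ofReal (w y))]
    (μ₀ : Measure Ω) [IsProbabilityMeasure μ₀] {M : ℝ} (hM1 : 1 ≤ M)
    (hup : μ₀ ≤ ENNReal.ofReal M • (q.withDensity fun y => ENNReal.ofReal (w y)))
    {E : Set (ℕ → Ω)} (hE : MeasurableSet E) (b : ℕ) :
    (Kernel.trajMeasure (X := fun _ : ℕ => Ω) μ₀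
        (fun n : ℕ => (indepMH q w).comap (fun h : (i : ↥(Finset.Iic n)) → Ω => h ⟨n, Finset.mem_Iic.2 le_rfl⟩)
          (measurable_pi_apply _))).real ((fun (x : ℕ → Ω) (n : ℕ) => x (b + n)) ⁻¹' E) ≤
      (1 + (M - 1) * (1 - (w x₀)⁻¹) ^ b) *
        (Kernel.trajMeasure (X := fun _ : ℕ => Ω) (q.withDensity fun y => ENNReal.ofReal (w y))
          (fun n : ℕ => (indepMH q w).comap (fun h : (i : ↥(Finset.Iic n)) → Ω => h ⟨n, Finset.mem_Iic.2 le_rfl⟩)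
            (measurable_pi_apply _))).real E := by
  have hW : 1 ≤ w x₀ := one_le_of_mode (q := q) hmax
  have hr0 : 0 ≤ 1 - (w x₀)⁻¹ := sub_nonneg.2 (inv_le_one_of_one_le₀ hW)
  have hc0 : 0 ≤ 1 + (M - 1) * (1 - (w x₀)⁻¹) ^ b :=
    add_nonneg zero_le_one (mul_nonneg (sub_nonneg.2 hM1) (pow_nonneg hr0 b))
  have hΘ : Measurable (fun (x : ℕ → Ω) (n : ℕ) => x (b + n)) :=
    measurable_pi_lambda _ fun n => measurable_pi_apply _
  haveI := isProbabilityMeasure_iterate_bind (κ := indepMH q w) μ₀ b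
  have hmono := chain_mono_measure (indepMH q w) (iterate_bind_indepMH_le_of_le (q := q) hw0 hmax μ₀ hM1 hup b)
  rw [← chain_map_shift_eq (indepMH q w) μ₀ b] at hmono
  have h := hmono E
  rw [Measure.map_apply hΘ hE] at h
  have hsmul := chain_add_smul (indepMH q w) (q.withDensity fun y => ENNReal.ofReal (w y)) 0
    (ENNReal.ofReal (1 + (M - 1) * (1 - (w x₀)⁻¹) ^ b)) 0
  simp only [smul_zero, add_zero, zero_smul] at hsmul
  rw [hsmul, Measure.smul_apply, smul_eq_mul] at h
  rw [measureReal_def, measureReal_def, ← ENNReal.toReal_ofReal hc0, ← ENNReal.toReal_mul]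
  exact ENNReal.toReal_mono (ENNReal.mul_ne_top ENNReal.ofReal_ne_top (measure_ne_top _ _)) h

/-- **WARM START, NONNEGATIVE STATISTICS, LOWER FACTOR**: `m·π ≤ μ₀` (`0 ≤ m`) ⇒ for every measurable `F` with
`0 ≤ F ≤ C`: `(1 − (1 − m)r^b)·E_π[F] ≤ E_{μ₀}[F(X_{b+·})]`. [ours] -/
theorem imh_chain_shift_integral_ge_of_ge [Fact (Measurable w)] (hw0 : ∀ y, 0 < w y) {x₀ : Ω}
    (hmax : ∀ y, w y ≤ w x₀) [IsProbabilityMeasure (q.withDensity fun y => ENNReal.ofReal (w y))]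
    (μ₀ : Measure Ω) [IsProbabilityMeasure μ₀] {m : ℝ} (hm0 : 0 ≤ m)
    (hlow : ENNReal.ofReal m • (q.withDensity fun y => ENNReal.ofReal (w y)) ≤ μ₀)
    {F : (ℕ → Ω) → ℝ} (hF : Measurable F) {C : ℝ} (hF0 : ∀ x, 0 ≤ F x) (hFC : ∀ x, F x ≤ C) (b : ℕ) :
    (1 - (1 - m) * (1 - (w x₀)⁻¹) ^ b) * ∫ x, F x ∂(Kernel.trajMeasure (X := fun _ : ℕ => Ω) (q.withDensity fun y => ENNReal.ofReal (w y))
        (fun n : ℕ => (indepMH q w).comap (fun h : (i : ↥(Finset.Iic n)) → Ω => h ⟨n, Finset.mem_Iic.2 le_rfl⟩)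
          (measurable_pi_apply _))) ≤ ∫ x, F (fun n => x (b + n)) ∂(Kernel.trajMeasure (X := fun _ : ℕ => Ω) μ₀
        (fun n : ℕ => (indepMH q w).comap (fun h : (i : ↥(Finset.Iic n)) → Ω => h ⟨n, Finset.mem_Iic.2 le_rfl⟩)
          (measurable_pi_apply _))) := by
  have hW : 1 ≤ w x₀ := one_le_of_mode (q := q) hmax
  have hr0 : 0 ≤ 1 - (w x₀)⁻¹ := sub_nonneg.2 (inv_le_one_of_one_le₀ hW)
  have hr1 : 1 - (w x₀)⁻¹ ≤ 1 := sub_le_self _ (inv_nonneg.mpr (hw0 x₀).le)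
  have hc0 : 0 ≤ 1 - (1 - m) * (1 - (w x₀)⁻¹) ^ b := by
    have : (1 - m) * (1 - (w x₀)⁻¹) ^ b ≤ 1 * 1 :=
      mul_le_mul (sub_le_self _ hm0) (pow_le_one₀ hr0 hr1) (pow_nonneg hr0 b) zero_le_one
    linarith
  have hCabs : ∀ x, |F x| ≤ max |(0 : ℝ)| |C| := fun x => abs_le_max_abs_abs (hF0 x) (hFC x)
  have hΘ : Measurable (fun (x : ℕ → Ω) (n : ℕ) => x (b + n)) :=
    measurable_pi_lambda _ fun n => measurable_pi_apply _
  haveI := isProbabilityMeasure_iterate_bind (κ := indepMH q w) μ₀ b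
  have hmono := chain_mono_measure (indepMH q w) (iterate_bind_indepMH_ge_of_ge (q := q) hw0 hmax μ₀ hm0 hlow b)
  rw [← chain_map_shift_eq (indepMH q w) μ₀ b] at hmono
  have hsmul := chain_add_smul (indepMH q w) (q.withDensity fun y => ENNReal.ofReal (w y)) 0
    (ENNReal.ofReal (1 - (1 - m) * (1 - (w x₀)⁻¹) ^ b)) 0
  simp only [smul_zero, add_zero, zero_smul] at hsmul
  rw [hsmul] at hmono
  haveI : IsProbabilityMeasure ((Kernel.trajMeasure (X := fun _ : ℕ => Ω) μ₀
        (fun n : ℕ => (indepMH q w).comap (fun h : (i : ↥(Finset.Iic n)) → Ω => h ⟨n, Finset.mem_Iic.2 le_rfl⟩)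
          (measurable_pi_apply _))).map (fun (x : ℕ → Ω) (n : ℕ) => x (b + n))) :=
    Measure.isProbabilityMeasure_map hΘ.aemeasurable
  have h := integral_mono_measure hmono (ae_of_all _ hF0) (integrable_of_bounded _ hF hCabs)
  rwa [integral_smul_measure, ENNReal.toReal_ofReal hc0, smul_eq_mul,
    integral_map hΘ.aemeasurable hF.aestronglyMeasurable] at h

/-- **WARM START, NONNEGATIVE STATISTICS, UPPER FACTOR**: `μ₀ ≤ M·π` (`M ≥ 1`) ⇒ for every measurable `F` with
`0 ≤ F ≤ C`: `E_{μ₀}[F(X_{b+·})] ≤ (1 + (M − 1)r^b)·E_π[F]` — relative accuracy of every nonnegative statistic. [ours] -/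
theorem imh_chain_shift_integral_le_of_le [Fact (Measurable w)] (hw0 : ∀ y, 0 < w y) {x₀ : Ω}
    (hmax : ∀ y, w y ≤ w x₀) [IsProbabilityMeasure (q.withDensity fun y => ENNReal.ofReal (w y))]
    (μ₀ : Measure Ω) [IsProbabilityMeasure μ₀] {M : ℝ} (hM1 : 1 ≤ M)
    (hup : μ₀ ≤ ENNReal.ofReal M • (q.withDensity fun y => ENNReal.ofReal (w y)))
    {F : (ℕ → Ω) → ℝ} (hF : Measurable F) {C : ℝ} (hF0 : ∀ x, 0 ≤ F x) (hFC : ∀ x, F x ≤ C) (b : ℕ) :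
    ∫ x, F (fun n => x (b + n)) ∂(Kernel.trajMeasure (X := fun _ : ℕ => Ω) μ₀
        (fun n : ℕ => (indepMH q w).comap (fun h : (i : ↥(Finset.Iic n)) → Ω => h ⟨n, Finset.mem_Iic.2 le_rfl⟩)
          (measurable_pi_apply _))) ≤ (1 + (M - 1) * (1 - (w x₀)⁻¹) ^ b) * ∫ x, F x ∂(Kernel.trajMeasure (X := fun _ : ℕ => Ω) (q.withDensity fun y => ENNReal.ofReal (w y))
        (fun n : ℕ => (indepMH q w).comap (fun h : (i : ↥(Finset.Iic n)) → Ω => h ⟨n, Finset.mem_Iic.2 le_rfl⟩)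
          (measurable_pi_apply _))) := by
  have hW : 1 ≤ w x₀ := one_le_of_mode (q := q) hmax
  have hr0 : 0 ≤ 1 - (w x₀)⁻¹ := sub_nonneg.2 (inv_le_one_of_one_le₀ hW)
  have hc0 : 0 ≤ 1 + (M - 1) * (1 - (w x₀)⁻¹) ^ b :=
    add_nonneg zero_le_one (mul_nonneg (sub_nonneg.2 hM1) (pow_nonneg hr0 b))
  have hCabs : ∀ x, |F x| ≤ max |(0 : ℝ)| |C| := fun x => abs_le_max_abs_abs (hF0 x) (hFC x)
  have hΘ : Measurable (fun (x : ℕ → Ω) (n : ℕ) => x (b + n)) :=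
    measurable_pi_lambda _ fun n => measurable_pi_apply _
  haveI := isProbabilityMeasure_iterate_bind (κ := indepMH q w) μ₀ b
  have hmono := chain_mono_measure (indepMH q w) (iterate_bind_indepMH_le_of_le (q := q) hw0 hmax μ₀ hM1 hup b)
  rw [← chain_map_shift_eq (indepMH q w) μ₀ b] at hmono
  have hsmul := chain_add_smul (indepMH q w) (q.withDensity fun y => ENNReal.ofReal (w y)) 0
    (ENNReal.ofReal (1 + (M - 1) * (1 - (w x₀)⁻¹) ^ b)) 0
  simp only [smul_zero, add_zero, zero_smul] at hsmul
  rw [hsmul] at hmono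
  have h := integral_mono_measure hmono (ae_of_all _ hF0)
    ((integrable_of_bounded _ hF hCabs).smul_measure ENNReal.ofReal_ne_top)
  rwa [integral_smul_measure, ENNReal.toReal_ofReal hc0, smul_eq_mul,
    integral_map hΘ.aemeasurable hF.aestronglyMeasurable] at h

/-- **THE HOT START ON PATH SPACE**: `P_q(X_{b+·} ∈ E) ≥ (1 − r^{b+1})·P_π(E)` for every measurable set of runs — from a
fresh draw of the flow, `b` discarded updates do what `b + 1` do from anywhere. [ours] -/
theorem imh_chain_shift_real_hotStart_ge [Fact (Measurable w)] (hw0 : ∀ y, 0 < w y) {x₀ : Ω}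
    (hmax : ∀ y, w y ≤ w x₀) [IsProbabilityMeasure (q.withDensity fun y => ENNReal.ofReal (w y))]
    {E : Set (ℕ → Ω)} (hE : MeasurableSet E) (b : ℕ) :
    (1 - (1 - (w x₀)⁻¹) ^ (b + 1)) *
        (Kernel.trajMeasure (X := fun _ : ℕ => Ω) (q.withDensity fun y => ENNReal.ofReal (w y))
          (fun n : ℕ => (indepMH q w).comap (fun h : (i : ↥(Finset.Iic n)) → Ω => h ⟨n, Finset.mem_Iic.2 le_rfl⟩)
            (measurable_pi_apply _))).real E ≤
      (Kernel.trajMeasure (X := fun _ : ℕ => Ω) q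
        (fun n : ℕ => (indepMH q w).comap (fun h : (i : ↥(Finset.Iic n)) → Ω => h ⟨n, Finset.mem_Iic.2 le_rfl⟩)
          (measurable_pi_apply _))).real ((fun (x : ℕ → Ω) (n : ℕ) => x (b + n)) ⁻¹' E) := by
  have hW : 1 ≤ w x₀ := one_le_of_mode (q := q) hmax
  have h := imh_chain_shift_real_ge_of_ge (q := q) hw0 hmax q (inv_nonneg.mpr (hw0 x₀).le)
    (hotStart_ge_target Fact.out hw0 hmax) hE b
  rwa [pow_succ']

end Summit.Ventures.LatticeQCDFlow.Exactness

end
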